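import Summits.FinalStateConjecture.FinalStateConjecture.Theorems.SeamedChartsExhaust.Negative.NoHoleCase
import Literature.Geometry.Lorentzian.CausalityPushUp
import Literature.Geometry.Lorentzian.KerrDataProofs
import Literature.Geometry.Lorentzian.KerrSchildCoord

/-!
# Kerr–Schild time is a time function; the static flow of Schwarzschild
# (negative-side support for crux `stmt-FinalStateConjecture-13551`, route `StarvedNecks`; cycle 2, part 1/4)

Lorentzian bookkeeping on the concrete spacetimes `Kerr.spacetime M a r₀` (`{r > max r₀ 0}` in ingoing
Kerr–Schild coordinates, under the instance hypothesis `[Kerr.Facts]`), used by the exact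
Schwarzschild model of the clause set of `SeamedChartsExhaust` (parts 2–4:
`ExactSchwarzschildModel`, `ExactSchwarzschildClauses`, `ExactSchwarzschildHorizon`):

* `line_mem_chronologicalFuture`: timelike variant of `line_mem_causalFuture` (`NoHoleCase.lean`) —
  coordinate lines through a chart along which `dΦ(v)` is future-directed AND timelike are timelike curves.
* `KerrTime.time_monotoneOn` / `time_antitoneOn` / `time_le_of_mem_causalPast` /
  `time_le_of_mem_causalFuture`: along a future causal curve `x⁰ ∘ γ` is monotone, because the time
  orientation `V = −g♯(dt*)` has `g(V, v) = −v⁰` (`Kerr.bilin_timeVector`); so `J⁻(S)` lies weakly below `S`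
  in `x⁰` — for ALL `M ≥ 0`, `a`, `r₀` (horizon-penetrating patches included).
* `Schw.vertical_mem_causalFuture` / `vertical_mem_chronologicalFuture`: for `a = 0` and `r > 2M` the
  static flow `x ↦ x + s ∂₀` (radius preserved) is future causal, and timelike for `s > 0`
  (`g(∂₀, ∂₀) = −1 + 2M/r`).

References: M. Dafermos, I. Rodnianski, *Lectures on black holes and linear waves*, arXiv:0811.0354, §5.1
(Schwarzschild/Kerr in ingoing Kerr–Schild coordinates, `∇t*` timelike); R. P. Kerr, A. Schild (1965), §3;
B. O'Neill, *Semi-Riemannian geometry*, Academic Press 1983, Ch. 14, pp. 402–403; M. Dafermos,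
G. Holzegel, I. Rodnianski, M. Taylor, arXiv:2104.08222, §1.
-/

noncomputable section

open TopologicalSpace Manifold Filter Topology Set Function
open scoped ContDiff Topology ENNReal Manifold

-- instance search through nested operator types `E4 →L E4 →L E4 →L ℝ` (as in the tree files)
set_option maxSynthPendingDepth 3

namespace Summit.FinalStateConjecture.FinalStateConjecture.Theorems.SeamedChartsExhaust.Negative

open Literature.Geometry.Lorentzian LorentzianMetric

section Flow

variable {𝓢 : Spacetime.{0} 4}

/-- Timelike variant of `line_mem_causalFuture`: if moreover `dΦ(v)` is timelike along `σ ∈ [0, s]`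
and `s > 0`, then `Φ(y) ≪ Φ(y + s v)`. O'Neill 1983, Ch. 14, p. 402. [folklore] -/
theorem line_mem_chronologicalFuture {U : Opens E4} {Φ : U → 𝓢.carrier}
    (hΦ : ContMDiff 𝓘(ℝ, E4) (𝓡 4) ∞ Φ) (v y : E4) (hy : y ∈ U) {s ε : ℝ} (hs : 0 < s) (hε : 0 < ε)
    (hmem : ∀ σ ∈ Icc (-ε) (s + ε), y + σ • v ∈ U)
    (hfut : ∀ z : U, z.1 ∈ (fun σ : ℝ ↦ y + σ • v) '' Icc 0 s →
      𝓢.timeOrientation.IsFutureDirected (mfderiv 𝓘(ℝ, E4) (𝓡 4) Φ z v))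
    (htl : ∀ z : U, z.1 ∈ (fun σ : ℝ ↦ y + σ • v) '' Icc 0 s →
      𝓢.metric.IsTimelike (mfderiv 𝓘(ℝ, E4) (𝓡 4) Φ z v)) :
    Φ ⟨y + s • v, hmem s ⟨by linarith, by linarith⟩⟩ ∈
      𝓢.metric.chronologicalFuture 𝓢.timeOrientation {Φ ⟨y, hy⟩} := by
  have hs' : 0 < s := hs
  -- clamp the parameter
  set c : ℝ → ℝ := fun σ ↦ max (-ε) (min σ (s + ε)) with hc
  have hcmem : ∀ σ, c σ ∈ Icc (-ε) (s + ε) := fun σ ↦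
    ⟨le_max_left _ _, max_le (by linarith) (min_le_right _ _)⟩
  have hcid : ∀ σ ∈ Ioo (-ε) (s + ε), c σ = σ := fun σ hσ ↦ by
    simp only [hc]
    rw [min_eq_left hσ.2.le, max_eq_right hσ.1.le]
  set ι : ℝ → U := fun σ ↦ ⟨y + c σ • v, hmem (c σ) (hcmem σ)⟩ with hι
  have hιval : ∀ σ, (ι σ).1 = y + c σ • v := fun σ ↦ rfl
  set γ : ℝ → 𝓢.carrier := fun σ ↦ Φ (ι σ) with hγ
  have hι0 : ι 0 = ⟨y, hy⟩ := Subtype.ext (by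
    rw [hιval, hcid 0 ⟨by linarith, by linarith⟩]; simp)
  have hιs : ι s = ⟨y + s • v, hmem s ⟨by linarith, by linarith⟩⟩ := Subtype.ext (by
    rw [hιval, hcid s ⟨by linarith, by linarith⟩])
  refine ⟨Φ ⟨y, hy⟩, rfl, γ, 0, s, hs', ?_, ?_, ?_⟩
  · intro t ht
    have htI : t ∈ Ioo (-ε) (s + ε) := ⟨by linarith [ht.1], by linarith [ht.2]⟩
    have hev : ∀ᶠ σ in 𝓝 t, c σ = σ :=
      Filter.eventually_of_mem (isOpen_Ioo.mem_nhds htI) fun σ hσ ↦ hcid σ hσ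
    have hval : (Subtype.val ∘ ι) =ᶠ[𝓝 t] fun σ : ℝ ↦ y + σ • v :=
      hev.mono fun σ hσ ↦ by simp only [Function.comp_apply, hιval, hσ]
    have haff : ContMDiff 𝓘(ℝ, ℝ) 𝓘(ℝ, E4) ∞ (fun σ : ℝ ↦ y + σ • v) :=
      (contDiff_const.add (contDiff_id.smul contDiff_const)).contMDiff
    have hιs' : ContMDiffAt 𝓘(ℝ, ℝ) 𝓘(ℝ, E4) ∞ ι t := by
      rw [← ContMDiffAt.subtypeVal_comp_iff]
      exact haff.contMDiffAt.congr_of_eventuallyEq hval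
    have hιd : MDifferentiableAt 𝓘(ℝ, ℝ) 𝓘(ℝ, E4) ι t := hιs'.mdifferentiableAt (by simp)
    have hΦd : MDifferentiableAt 𝓘(ℝ, E4) (𝓡 4) Φ (ι t) := hΦ.mdifferentiableAt (by simp)
    have hγd : MDifferentiableAt 𝓘(ℝ, ℝ) (𝓡 4) γ t := hΦd.comp t hιd
    -- the velocity of `ι` is `v`
    have hder : HasDerivAt (fun σ : ℝ ↦ y + σ • v) v t := by
      simpa using ((hasDerivAt_id t).smul_const v).const_add y
    have h3 : mfderiv 𝓘(ℝ, ℝ) 𝓘(ℝ, E4) (fun σ : ℝ ↦ y + σ • v) t (1 : ℝ) = v := by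
      rw [mfderiv_eq_fderiv]
      change fderiv ℝ (fun σ : ℝ ↦ y + σ • v) t 1 = v
      rw [hder.hasFDerivAt.fderiv]
      simp
    have hvι : mfderiv 𝓘(ℝ, ℝ) 𝓘(ℝ, E4) ι t (1 : ℝ) = v := by
      have h1 : mfderiv 𝓘(ℝ, ℝ) 𝓘(ℝ, E4) (Subtype.val ∘ ι) t =
          (mfderiv 𝓘(ℝ, E4) 𝓘(ℝ, E4) (Subtype.val : U → E4) (ι t)).comp
            (mfderiv 𝓘(ℝ, ℝ) 𝓘(ℝ, E4) ι t) :=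
        mfderiv_comp t
          ((contMDiff_subtype_val : ContMDiff 𝓘(ℝ, E4) 𝓘(ℝ, E4) ∞ (Subtype.val : U → E4)).mdifferentiableAt
            (by simp)) hιd
      have h2 : mfderiv 𝓘(ℝ, ℝ) 𝓘(ℝ, E4) (Subtype.val ∘ ι) t =
          mfderiv 𝓘(ℝ, ℝ) 𝓘(ℝ, E4) (fun σ : ℝ ↦ y + σ • v) t := hval.mfderiv_eq
      have h4 : (mfderiv 𝓘(ℝ, E4) 𝓘(ℝ, E4) (Subtype.val : U → E4) (ι t))
          ((mfderiv 𝓘(ℝ, ℝ) 𝓘(ℝ, E4) ι t) (1 : ℝ)) =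
          (mfderiv 𝓘(ℝ, ℝ) 𝓘(ℝ, E4) (fun σ : ℝ ↦ y + σ • v) t) (1 : ℝ) := by
        have := congrArg (fun L ↦ L (1 : ℝ)) h1
        rw [h2] at this
        exact this.symm
      rw [h3, OpensChart.mfderiv_subtypeVal_apply] at h4
      exact h4
    have hvel : velocity (𝓡 4) γ t = mfderiv 𝓘(ℝ, E4) (𝓡 4) Φ (ι t) v := by
      unfold velocity
      rw [show γ = Φ ∘ ι from rfl, mfderiv_comp t hΦd hιd]
      show (mfderiv 𝓘(ℝ, E4) (𝓡 4) Φ (ι t)) ((mfderiv 𝓘(ℝ, ℝ) 𝓘(ℝ, E4) ι t) (1 : ℝ)) = _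
      rw [hvι]
    have hmemt : (ι t).1 ∈ (fun σ : ℝ ↦ y + σ • v) '' Icc 0 s := by
      refine ⟨c t, ?_, (hιval t).symm⟩
      rw [hcid t htI]
      exact ht
    refine ⟨hγd, ?_, ?_⟩
    · rw [hvel]
      exact htl (ι t) hmemt
    · rw [hvel]
      exact hfut (ι t) hmemt
  · show Φ (ι 0) = Φ ⟨y, hy⟩
    rw [hι0]
  · show Φ (ι s) = Φ ⟨y + s • v, hmem s ⟨by linarith, by linarith⟩⟩
    rw [hιs]



end Flow

/-! ## The exact Schwarzschild model (`N = 1`, identity charts) -/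

-- `Kerr.spacetime` takes the instance hypothesis `[Kerr.Facts]` (analyticity/connectedness facts of the
-- Kerr–Schild chart, all proved in the tree); it is kept as a hypothesis here and INSTANTIATED by the model
-- file `ExactSchwarzschildModel.lean` (`SchwModel.kerrFacts`).
variable [Kerr.Facts]

namespace KerrTime

variable {M a r₀ : ℝ} {hM : 0 ≤ M}

-- `TangentSpace 𝓘(ℝ, ℝ) s` is definitionally `ℝ`; reading the manifold derivative of the real function
-- `x⁰ ∘ γ` as an ordinary derivative moves across this identification (same pattern as
-- `RedShiftedHorizon.monotoneOn_comp_of_isMIntegralCurveOn`).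
set_option backward.isDefEq.respectTransparency false in
/-- Chain rule: the Kerr–Schild time `x⁰ ∘ γ` of a differentiable curve in the Kerr–Schild patch
`{r > r₀}` has derivative `(γ'(s))⁰`. [folklore] -/
theorem hasDerivAt_time_comp {γ : ℝ → (Kerr.spacetime M a r₀ hM).carrier} {s : ℝ}
    (hγ : MDifferentiableAt 𝓘(ℝ, ℝ) (𝓡 4) γ s) :
    HasDerivAt (fun s ↦ (γ s).1 0) ((show E4 from velocity (𝓡 4) γ s) 0) s := by
  set P : E4 →L[ℝ] ℝ := EuclideanSpace.proj (0 : Fin 4) with hP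
  have hφ : HasMFDerivAt (𝓡 4) 𝓘(ℝ, ℝ)
      (fun x : (Kerr.spacetime M a r₀ hM).carrier ↦ P x.1) (γ s)
      (P.comp (ContinuousLinearMap.id ℝ E4)) :=
    P.hasMFDerivAt.comp (γ s) (hasMFDerivAt_subtypeVal (I' := 𝓡 4) (γ s))
  rw [hasDerivAt_iff_hasFDerivAt, ← hasMFDerivAt_iff_hasFDerivAt]
  apply (hφ.comp s hγ.hasMFDerivAt).congr_mfderiv
  rw [ContinuousLinearMap.ext_iff]
  intro (r : ℝ)
  have hr : (mfderiv 𝓘(ℝ, ℝ) (𝓡 4) γ s) r = r • (mfderiv 𝓘(ℝ, ℝ) (𝓡 4) γ s) (1 : ℝ) := by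
    rw [← map_smul]
    congr 1
    exact (mul_one r).symm
  change P ((mfderiv 𝓘(ℝ, ℝ) (𝓡 4) γ s) r) = r • (show E4 from velocity (𝓡 4) γ s) 0
  rw [hr, map_smul, smul_eq_mul, smul_eq_mul]
  rfl

/-- Future-directed vectors have positive time component: `g(V, v) = −v⁰ < 0` for `V = −g♯(dt*)`.
Dafermos–Rodnianski arXiv:0811.0354, §5.1. [folklore] -/
theorem velocity_zero_pos {x : (Kerr.spacetime M a r₀ hM).carrier} {v : E4}
    (hv : (Kerr.spacetime M a r₀ hM).timeOrientation.IsFutureDirected (x := x) v) : 0 < v 0 := by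
  have h2 := hv.2
  change Kerr.bilin M a x.1 (Kerr.timeVector M a x.1) v < 0 at h2
  rw [Kerr.bilin_timeVector (Kerr.radius_pos_of_mem_region x.2)] at h2
  simpa using h2

/-- Dually, future-directed vectors of the REVERSED orientation have negative time component.
[folklore] -/
theorem velocity_zero_neg {x : (Kerr.spacetime M a r₀ hM).carrier} {v : E4}
    (hv : (Kerr.spacetime M a r₀ hM).timeOrientation.reverse.IsFutureDirected (x := x) v) :
    v 0 < 0 := by
  rw [TimeOrientation.isFutureDirected_reverse_iff] at hv
  have h2 := hv.2
  change 0 < Kerr.bilin M a x.1 (Kerr.timeVector M a x.1) v at h2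
  rw [Kerr.bilin_timeVector (Kerr.radius_pos_of_mem_region x.2)] at h2
  simpa using h2

/-- **Kerr–Schild time is a time function on every Kerr–Schild patch** `{r > max r₀ 0}`, for all
`M ≥ 0` and all `a`: along a future causal curve the coordinate `x⁰ ∘ γ` is monotone (its
derivative is `(γ')⁰ = −g(V, γ') > 0`). Dafermos–Rodnianski arXiv:0811.0354, §5.1. [folklore] -/
theorem time_monotoneOn {γ : ℝ → (Kerr.spacetime M a r₀ hM).carrier} {s₁ s₂ : ℝ}
    (hγ : (Kerr.spacetime M a r₀ hM).metric.IsFutureCausalCurveOn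
      (Kerr.spacetime M a r₀ hM).timeOrientation γ (Icc s₁ s₂)) :
    MonotoneOn (fun s ↦ (γ s).1 0) (Icc s₁ s₂) := by
  have hcont : ContinuousOn (fun s ↦ (γ s).1 0) (Icc s₁ s₂) := fun s hs ↦
    (((PiLp.continuous_apply 2 _ 0).comp continuous_subtype_val).continuousAt.comp
      (hγ.continuousAt hs)).continuousWithinAt
  refine monotoneOn_of_hasDerivWithinAt_nonneg (convex_Icc s₁ s₂) hcont
    (fun s hs ↦ (hasDerivAt_time_comp (hγ s (interior_subset hs)).1).hasDerivWithinAt)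
    fun s hs ↦ (velocity_zero_pos (hγ s (interior_subset hs)).2).le

/-- Along a future causal curve of the REVERSED orientation, `x⁰ ∘ γ` is antitone. [folklore] -/
theorem time_antitoneOn {γ : ℝ → (Kerr.spacetime M a r₀ hM).carrier} {s₁ s₂ : ℝ}
    (hγ : (Kerr.spacetime M a r₀ hM).metric.IsFutureCausalCurveOn
      (Kerr.spacetime M a r₀ hM).timeOrientation.reverse γ (Icc s₁ s₂)) :
    AntitoneOn (fun s ↦ (γ s).1 0) (Icc s₁ s₂) := by
  have hcont : ContinuousOn (fun s ↦ (γ s).1 0) (Icc s₁ s₂) := fun s hs ↦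
    (((PiLp.continuous_apply 2 _ 0).comp continuous_subtype_val).continuousAt.comp
      (hγ.continuousAt hs)).continuousWithinAt
  refine antitoneOn_of_hasDerivWithinAt_nonpos (convex_Icc s₁ s₂) hcont
    (fun s hs ↦ (hasDerivAt_time_comp (hγ s (interior_subset hs)).1).hasDerivWithinAt)
    fun s hs ↦ (velocity_zero_neg (hγ s (interior_subset hs)).2).le

/-- `J⁻(S)` lies weakly below `S` in Kerr–Schild time. [folklore] -/
theorem time_le_of_mem_causalPast {S : Set (Kerr.spacetime M a r₀ hM).carrier}
    {p : (Kerr.spacetime M a r₀ hM).carrier}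
    (hp : p ∈ (Kerr.spacetime M a r₀ hM).metric.causalPast
      (Kerr.spacetime M a r₀ hM).timeOrientation S) :
    ∃ q ∈ S, p.1 0 ≤ q.1 0 := by
  rcases hp with hp | ⟨q, hq, γ, s₁, s₂, hs, hγ, hγ₁, hγ₂⟩
  · exact ⟨p, hp, le_rfl⟩
  · refine ⟨q, hq, ?_⟩
    have h := time_antitoneOn hγ ⟨le_rfl, hs.le⟩ ⟨hs.le, le_rfl⟩ hs.le
    simp only at h
    rw [hγ₁, hγ₂] at h
    exact h

/-- `J⁺(p)` lies weakly above `p` in Kerr–Schild time. [folklore] -/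
theorem time_le_of_mem_causalFuture {p q : (Kerr.spacetime M a r₀ hM).carrier}
    (hq : q ∈ (Kerr.spacetime M a r₀ hM).metric.causalFuture
      (Kerr.spacetime M a r₀ hM).timeOrientation {p}) :
    p.1 0 ≤ q.1 0 := by
  rcases hq with hq | ⟨p', hp', γ, s₁, s₂, hs, hγ, hγ₁, hγ₂⟩
  · rw [mem_singleton_iff] at hq; rw [hq]
  · rw [mem_singleton_iff] at hp'
    subst hp'
    have h := time_monotoneOn hγ ⟨le_rfl, hs.le⟩ ⟨hs.le, le_rfl⟩ hs.le
    simp only at h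
    rw [hγ₁, hγ₂] at h
    exact h

end KerrTime

/-! ### Schwarzschild Kerr–Schild algebra along the static Killing field `∂₀` -/

namespace Schw

omit [Kerr.Facts] in
/-- Vertical displacement by `σ` raises `x⁰` by `σ`. [folklore] -/
theorem add_smul_e0_apply_zero (x : E4) (σ : ℝ) : (x + σ • E4.basisVector 0) 0 = x 0 + σ := by
  simp

omit [Kerr.Facts] in
/-- `H = M / r` for `a = 0` wherever `r > 0` (Schwarzschild). [folklore] -/
theorem scalarH_zero (M : ℝ) {x : E4} (hx : 0 < Kerr.radius 0 x) :
    Kerr.scalarH M 0 x = M / Kerr.radius 0 x := by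
  unfold Kerr.scalarH
  have hr : Kerr.radius 0 x ≠ 0 := hx.ne'
  field_simp
  ring

omit [Kerr.Facts] in
/-- Outside the Schwarzschild radius `∂₀` is timelike: `g(∂₀, ∂₀) = −1 + 2M/r < 0` for
`r > 2M ≥ 0`. [folklore] -/
theorem bilin_e0_e0_neg {M : ℝ} (hM : 0 ≤ M) {x : E4} (hx : 2 * M < Kerr.radius 0 x) :
    Kerr.bilin M 0 x (E4.basisVector 0) (E4.basisVector 0) < 0 := by
  have hr : 0 < Kerr.radius 0 x := by linarith
  rw [Kerr.bilin_apply, Kerr.nullCovector_basisVector_zero, Minkowski.bilin_basisVector_zero,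
    scalarH_zero M hr, mul_one, mul_one]
  have : M / Kerr.radius 0 x < 1 / 2 := by
    rw [div_lt_iff₀ hr]; linarith
  linarith

omit [Kerr.Facts] in
/-- `∂₀ ≠ 0`. [folklore] -/
theorem basisVector_zero_ne_zero : (E4.basisVector 0 : E4) ≠ 0 := by
  intro h
  have := congrArg (fun z : E4 ↦ z 0) h
  simp at this

variable {M r₀ : ℝ} {hM : 0 ≤ M}

/-- In the Schwarzschild patch `{r > r₀}`, `∂₀` is future-directed causal at every point with
`r > 2M`. [folklore] -/
theorem isFutureDirected_e0 (x : (Kerr.spacetime M 0 r₀ hM).carrier)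
    (hx : 2 * M < Kerr.radius 0 x.1) :
    (Kerr.spacetime M 0 r₀ hM).timeOrientation.IsFutureDirected (x := x) (E4.basisVector 0 : E4) := by
  refine ⟨⟨?_, basisVector_zero_ne_zero⟩, ?_⟩
  · change Kerr.bilin M 0 x.1 (E4.basisVector 0) (E4.basisVector 0) ≤ 0
    exact (bilin_e0_e0_neg hM hx).le
  · change Kerr.bilin M 0 x.1 (Kerr.timeVector M 0 x.1) (E4.basisVector 0) < 0
    rw [Kerr.bilin_timeVector (Kerr.radius_pos_of_mem_region x.2)]
    simp

/-- `∂₀` is timelike at points of the patch with `r > 2M` (Schwarzschild). [folklore] -/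
theorem isTimelike_e0 (x : (Kerr.spacetime M 0 r₀ hM).carrier) (hx : 2 * M < Kerr.radius 0 x.1) :
    (Kerr.spacetime M 0 r₀ hM).metric.IsTimelike (x := x) (E4.basisVector 0 : E4) := by
  change Kerr.bilin M 0 x.1 (E4.basisVector 0) (E4.basisVector 0) < 0
  exact bilin_e0_e0_neg hM hx

omit [Kerr.Facts] in
/-- The differential of the identity map of the patch is the identity. [folklore] -/
theorem mfderiv_self_apply (z : Kerr.region (0 : ℝ) r₀) (v : E4) :
    mfderiv 𝓘(ℝ, E4) (𝓡 4) (fun z : Kerr.region (0 : ℝ) r₀ ↦ z) z v = v := by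
  have : (fun z : Kerr.region (0 : ℝ) r₀ ↦ z) = id := rfl
  rw [this]
  erw [mfderiv_id]
  rfl

/-- **The static flow is causal**: for `x` in the patch with `r(x) > 2M` and `s ≥ 0`, the point
`x + s ∂₀` (same radius) lies in `J⁺(x)`. [folklore] -/
theorem vertical_mem_causalFuture (x : (Kerr.spacetime M 0 r₀ hM).carrier)
    (hx : 2 * M < Kerr.radius 0 x.1) {s : ℝ} (hs : 0 ≤ s)
    (hmem : x.1 + s • E4.basisVector 0 ∈ Kerr.region 0 r₀) :
    (⟨x.1 + s • E4.basisVector 0, hmem⟩ : (Kerr.spacetime M 0 r₀ hM).carrier) ∈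
      (Kerr.spacetime M 0 r₀ hM).metric.causalFuture (Kerr.spacetime M 0 r₀ hM).timeOrientation
        {x} := by
  have hmem' : ∀ σ ∈ Icc (-1) (s + 1), x.1 + σ • E4.basisVector 0 ∈ Kerr.region 0 r₀ := by
    intro σ _
    show max r₀ 0 < Kerr.radius 0 (x.1 + σ • E4.basisVector 0)
    rw [Kerr.radius_add_time_smul_basisVector]; exact x.2
  have key := line_mem_causalFuture (𝓢 := Kerr.spacetime M 0 r₀ hM) (U := Kerr.region 0 r₀)
    (Φ := fun z ↦ z) contMDiff_id (E4.basisVector 0) x.1 x.2 hs one_pos hmem' (by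
      rintro z ⟨σ, -, hz⟩
      have hrad : 2 * M < Kerr.radius 0 z.1 := by rw [← hz, Kerr.radius_add_time_smul_basisVector]; exact hx
      exact (congrArg (fun w : E4 ↦ (Kerr.spacetime M 0 r₀ hM).timeOrientation.IsFutureDirected
        (x := z) w) (mfderiv_self_apply z (E4.basisVector 0))).mpr
          (isFutureDirected_e0 (hM := hM) z hrad))
  exact key

/-- **The static flow is timelike**: `x ≪ x + s ∂₀` for `s > 0` and `r(x) > 2M`. [folklore] -/
theorem vertical_mem_chronologicalFuture (x : (Kerr.spacetime M 0 r₀ hM).carrier)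
    (hx : 2 * M < Kerr.radius 0 x.1) {s : ℝ} (hs : 0 < s)
    (hmem : x.1 + s • E4.basisVector 0 ∈ Kerr.region 0 r₀) :
    (⟨x.1 + s • E4.basisVector 0, hmem⟩ : (Kerr.spacetime M 0 r₀ hM).carrier) ∈
      (Kerr.spacetime M 0 r₀ hM).metric.chronologicalFuture
        (Kerr.spacetime M 0 r₀ hM).timeOrientation {x} := by
  have hmem' : ∀ σ ∈ Icc (-1) (s + 1), x.1 + σ • E4.basisVector 0 ∈ Kerr.region 0 r₀ := by
    intro σ _
    show max r₀ 0 < Kerr.radius 0 (x.1 + σ • E4.basisVector 0)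
    rw [Kerr.radius_add_time_smul_basisVector]; exact x.2
  have key := line_mem_chronologicalFuture (𝓢 := Kerr.spacetime M 0 r₀ hM)
    (U := Kerr.region 0 r₀) (Φ := fun z ↦ z) contMDiff_id (E4.basisVector 0) x.1 x.2 hs one_pos
    hmem' (by
      rintro z ⟨σ, -, hz⟩
      have hrad : 2 * M < Kerr.radius 0 z.1 := by rw [← hz, Kerr.radius_add_time_smul_basisVector]; exact hx
      exact (congrArg (fun w : E4 ↦ (Kerr.spacetime M 0 r₀ hM).timeOrientation.IsFutureDirected
        (x := z) w) (mfderiv_self_apply z (E4.basisVector 0))).mpr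
          (isFutureDirected_e0 (hM := hM) z hrad)) (by
      rintro z ⟨σ, -, hz⟩
      have hrad : 2 * M < Kerr.radius 0 z.1 := by rw [← hz, Kerr.radius_add_time_smul_basisVector]; exact hx
      exact (congrArg (fun w : E4 ↦ (Kerr.spacetime M 0 r₀ hM).metric.IsTimelike (x := z) w)
        (mfderiv_self_apply z (E4.basisVector 0))).mpr (isTimelike_e0 (hM := hM) z hrad))
  exact key

end Schw
end Summit.FinalStateConjecture.FinalStateConjecture.Theorems.SeamedChartsExhaust.Negative

end
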